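import Summits.AnomalousDissipation.AnomalousDissipation.Theses.TameRoughRigidity
import Literature.Analysis.FluidPDE.CylindricalGenerator
import HarnessLib

/-!
# Sketch — crux idea `galerkin-soft-closure` for `TameRoughRigidity.TameClosure` (stmt-AnomalousDissipation-18402)

First lemmas of the line (statements only; they elaborate, proofs are `sorry`):

* `galerkinCyl K ψ` — the level-`K` GALERKIN cylindrical test with an ARBITRARY `C¹_c` profile `ψ`
  over the Parseval frame coordinates of `P_K H` (generalises the tree's `Torus.galerkinTest`, whose
  profile is the fixed radial one).
* `transStress K Φ v = ∫ ⟪(∇Φ'(v)) Q_K v, Q_K v⟫` — the TRANSVERSE Reynolds stress (the only part of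
  the generator pairing that is invisible to compact support in the frame coordinates).
* (A) `galerkin_linearGrowth_split` — FINITE-DIMENSIONAL TRIVIALITY: on a level-`K` Galerkin test the
  generator pairing minus the transverse stress is continuous with LINEAR growth in `‖v‖`, and the
  transverse stress is `≤ N/(4π²(K²+1)) · ‖∇v‖²` pointwise.
* (B) `linearGrowth_limit` — linear-growth continuous observables pass to weak limits under a uniform
  second moment (soft uniform integrability).
* (C) `galerkin_nearIdentity_of_tameLimit` — a tame weak limit of Φ-uniformly near-stationary tame
  statistics is Galerkin-stationary up to `2 N G₁ /(4π²(K²+1))`.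
-/

set_option linter.dupNamespace false

noncomputable section

namespace Summit.AnomalousDissipation.AnomalousDissipation.Cruxes.TameClosure.GalerkinSoftClosure

open MeasureTheory Filter Topology UnitAddTorus
open scoped InnerProductSpace RealInnerProductSpace ENNReal NNReal
open Literature.Analysis.FunctionSpaces Literature.Analysis.FluidPDE
open Summit.AnomalousDissipation.AnomalousDissipation.Theses.TameRoughRigidity

/-- Local notation: real vector fields on `T³`. -/
local notation "Vec3" => (UnitAddTorus (Fin 3)) → (EuclideanSpace ℝ (Fin 3))
/-- Local notation: `L²(T³; ℝ³)`. -/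
local notation "L2" => (Lp (EuclideanSpace ℝ (Fin 3)) 2 (volume : Measure (UnitAddTorus (Fin 3))))
/-- Local notation: the energy space `H`. -/
local notation "H3" => (Torus.energySpace (Fin 3))

/-- The level-`K` Galerkin cylindrical test with an arbitrary `C¹_c` profile `ψ` over the frame
coordinates `(v, g_p)`, `p ∈ FrameIdx (Fin 3) K` (so `Φ(v) = ψ(coords v)` depends on `P_K v` only and
`Φ'(v) = Σ_p ∂_pψ(coords v) g_p ∈ P_K H`). -/
def galerkinCyl (K : ℕ) (ψ : EuclideanSpace ℝ (Fin (Fintype.card (Torus.FrameIdx (Fin 3) K))) → ℝ)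
    (hψ : ContDiff ℝ 1 ψ) (hc : HasCompactSupport ψ) : Torus.CylindricalTest (Fin 3) where
  m := Fintype.card (Torus.FrameIdx (Fin 3) K)
  g i := Torus.frameFieldIdx K ((Fintype.equivFin (Torus.FrameIdx (Fin 3) K)).symm i)
  g_smooth _ := Literature.Analysis.FunctionSpaces.Torus.isSmooth_realTrigPoly _ _
  g_divFree _ := Torus.isDivFree_frameField (Torus.ne_zero_of_mem_freqBall₀ _) _ _
  g_zeroMean _ := Torus.integral_frameField (Torus.ne_zero_of_mem_freqBall₀ _) _ _
  φ := ψ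
  φ_contDiff := hψ
  φ_compact := hc

/-- The bilinear stress pairing `∫ ⟪(∇g)(x) a(x), b(x)⟫ dx` (so that `Torus.inertialPairing u g` is the
diagonal `a = b = u`). -/
def stressPairing (a b g : Vec3) : ℝ :=
  ∫ x, ⟪Literature.Analysis.FunctionSpaces.Torus.fderiv g x (a x), b x⟫_ℝ

/-- The spectral tail `Q_K v = v − P_K v` of `v ∈ H`, as a field. -/
def tailField (K : ℕ) (v : H3) : Vec3 := fun x =>
  ((v : L2) : Vec3) x - Literature.Analysis.FunctionSpaces.Torus.fourierTruncate K ((v : L2) : Vec3) x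

/-- The TRANSVERSE Reynolds stress of `v` against the gradient of `Φ`: `∫ ⟪(∇Φ'(v)) Q_K v, Q_K v⟫`. -/
def transStress (K : ℕ) (Φ : Torus.CylindricalTest (Fin 3)) (v : H3) : ℝ :=
  stressPairing (tailField K v) (tailField K v) (Φ.grad v)

/-- **(A) Finite-dimensional triviality — the Galerkin linear-growth split.** For a smooth force `f`
and a level-`K` Galerkin test `Φ = galerkinCyl K ψ`: the observable
`U(v) = ⟨f − B(v,v), Φ'(v)⟩ − transStress K Φ v` (force term + `P⊗P` + `P⊗Q` + `Q⊗P` stresses) is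
continuous on `H` with LINEAR growth `|U(v)| ≤ a + b‖v‖` (because `Φ'(v) = 0` unless `|P_K v| ≤ R_ψ`),
and the transverse stress obeys the pointwise tame bound
`|transStress| ≤ N ‖Q_K v‖² ≤ N/(4π²(K²+1)) ‖∇v‖²` with `N = sup_v ‖∇Φ'(v)‖_∞ < ∞`. -/
theorem galerkin_linearGrowth_split (f : Vec3) (hf : Torus.IsSmooth f) (K : ℕ)
    (ψ : EuclideanSpace ℝ (Fin (Fintype.card (Torus.FrameIdx (Fin 3) K))) → ℝ)
    (hψ : ContDiff ℝ 1 ψ) (hc : HasCompactSupport ψ) :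
    ∃ a b N : ℝ, 0 ≤ N ∧
      Continuous (fun v : H3 =>
        Torus.nsGeneratorPairing 0 f v ((galerkinCyl K ψ hψ hc).grad v) -
          transStress K (galerkinCyl K ψ hψ hc) v) ∧
      (∀ v : H3, |Torus.nsGeneratorPairing 0 f v ((galerkinCyl K ψ hψ hc).grad v) -
          transStress K (galerkinCyl K ψ hψ hc) v| ≤ a + b * ‖v‖) ∧
      (∀ v : H3, ENNReal.ofReal |transStress K (galerkinCyl K ψ hψ hc) v| ≤
          ENNReal.ofReal (N / (4 * Real.pi ^ 2 * ((K : ℝ) ^ 2 + 1))) *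
            Torus.eGradNormSq ((v : L2) : Vec3)) := by
  sorry

/-- **(B) Soft uniform integrability.** Linear-growth continuous observables pass to weak limits of
probability measures with a uniform second moment. -/
theorem linearGrowth_limit (μ : ℕ → Measure H3) (μ' : Measure H3)
    (hprob : ∀ n, IsProbabilityMeasure (μ n)) (hprob' : IsProbabilityMeasure μ')
    (hweak : ∀ h : H3 → ℝ, Continuous h → (∃ C : ℝ, ∀ v, |h v| ≤ C) →
      Tendsto (fun n => ∫ v, h v ∂(μ n)) atTop (𝓝 (∫ v, h v ∂μ')))
    (E : ℝ) (hint : ∀ n, Integrable (fun v : H3 => ‖v‖ ^ 2) (μ n))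
    (hE : ∀ n, Torus.ensembleEnergy (μ n) ≤ E) (hint' : Integrable (fun v : H3 => ‖v‖ ^ 2) μ')
    (U : H3 → ℝ) (hU : Continuous U) (a b : ℝ) (hab : ∀ v, |U v| ≤ a + b * ‖v‖) :
    Tendsto (fun n => ∫ v, U v ∂(μ n)) atTop (𝓝 (∫ v, U v ∂μ')) := by
  sorry

/-- **(C) Galerkin near-identity of tame weak limits.** If tame `(E, G₁)` probability measures `μ n`
with Φ-uniform cylindrical forced-Euler defect `≤ r n → 0` converge against bounded continuous
observables to a tame `μ'`, then for every level-`K` Galerkin test the limit defect is at most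
`2 N G₁ / (4π²(K²+1))` (with the `N` of (A)). -/
theorem galerkin_nearIdentity_of_tameLimit (f : Vec3) (hf : Torus.IsSmooth f) (E G₁ : ℝ) (hG₁ : 0 ≤ G₁)
    (μ : ℕ → Measure H3) (μ' : Measure H3) (r : ℕ → ℝ) (hr : Tendsto r atTop (𝓝 0))
    (hprob : ∀ n, IsProbabilityMeasure (μ n)) (hint : ∀ n, Integrable (fun v : H3 => ‖v‖ ^ 2) (μ n))
    (hE : ∀ n, Torus.ensembleEnergy (μ n) ≤ E)
    (hG : ∀ n, Torus.ensembleEnstrophy (μ n) ≤ ENNReal.ofReal G₁)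
    (hdef : ∀ n (Φ : Torus.CylindricalTest (Fin 3)),
      Integrable (fun v : H3 => Torus.nsGeneratorPairing 0 f v (Φ.grad v)) (μ n) ∧
        |∫ v, Torus.nsGeneratorPairing 0 f v (Φ.grad v) ∂(μ n)| ≤
          r n * Real.sqrt (∫ v, Torus.gradNormSq (Φ.grad v) ∂(μ n)))
    (hprob' : IsProbabilityMeasure μ') (hint' : Integrable (fun v : H3 => ‖v‖ ^ 2) μ')
    (hE' : Torus.ensembleEnergy μ' ≤ E) (hG' : Torus.ensembleEnstrophy μ' ≤ ENNReal.ofReal G₁)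
    (hweak : ∀ h : H3 → ℝ, Continuous h → (∃ C : ℝ, ∀ v, |h v| ≤ C) →
      Tendsto (fun n => ∫ v, h v ∂(μ n)) atTop (𝓝 (∫ v, h v ∂μ')))
    (K : ℕ) (ψ : EuclideanSpace ℝ (Fin (Fintype.card (Torus.FrameIdx (Fin 3) K))) → ℝ)
    (hψ : ContDiff ℝ 1 ψ) (hc : HasCompactSupport ψ) :
    ∃ N : ℝ, 0 ≤ N ∧
      (∀ (v : H3) (x : UnitAddTorus (Fin 3)) (e : EuclideanSpace ℝ (Fin 3)),
        ‖Literature.Analysis.FunctionSpaces.Torus.fderiv ((galerkinCyl K ψ hψ hc).grad v) x e‖ ≤ N * ‖e‖) ∧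
      Integrable (fun v : H3 => Torus.nsGeneratorPairing 0 f v ((galerkinCyl K ψ hψ hc).grad v)) μ' ∧
      |∫ v, Torus.nsGeneratorPairing 0 f v ((galerkinCyl K ψ hψ hc).grad v) ∂μ'| ≤
        2 * N * G₁ / (4 * Real.pi ^ 2 * ((K : ℝ) ^ 2 + 1)) := by
  sorry

end Summit.AnomalousDissipation.AnomalousDissipation.Cruxes.TameClosure.GalerkinSoftClosure

end
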